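import Summits.QuantumAdvantage.AdviceFreeQNC0.AugmentedCode
import HarnessLib

/-!
# Cell qa-qnc0 — the augmented elimination code, II: win patterns, fail patterns, `InCPlus`

Sequel to `AugmentedCode.lean` (line `tensor` of the route crux `RingToElim`): the Boolean
vocabulary of the skeleton meets the `𝔽₂` model.

* `inCPlus_win`, `inCPlus_fail` — win (fail) patterns of degree-`d` stakes satisfy `InCPlus d`
  (pieces `winBit c (a u) (b u) t`, `t = 0,1,2`, summing to `0` (`1`));
* `indZ_mem_cplus_of_inCPlus` — `InCPlus d f → indZ f ∈ cplus L d`;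
* `indZ_win_mem_code`, `indZ_fail_add_one_mem_code` — win patterns lie in `C`, fail patterns in
  the odd coset `𝟙 + C`.
-/

namespace Summit.QuantumAdvantage.AdviceFreeQNC0

open Finset Literature.Computability.MetaComplexity Literature.Computability.MetaComplexity.Smolensky

variable {L : ℕ}

/-- The constant `1` has degree `0`. -/
private theorem one_mem_lowDeg₃ (L d : ℕ) : (1 : CubeFn (ZMod 2) L) ∈ lowDeg (ZMod 2) L d := by
  rw [← mono_empty]
  exact mono_mem_lowDeg (by simp)

/-! ### Win patterns, fail patterns and `InCPlus` in the model -/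

/-- The win bit of class-`c` stakes evaluated at residue `t`. -/
def winBit (c : ℕ) (α β : Bool) (t : ℕ) : Bool := !(elimFailBits c α β t)

/-- `winBit` as a function of the stakes is one of `β, α, α ⊕ β` — of the degree of the stakes. -/
theorem hasDeg_winBit {k d : ℕ} (c t : ℕ) {a b : (Fin k → Bool) → Bool} (ha : HasDeg a d) (hb : HasDeg b d) :
    HasDeg (fun u => winBit c (a u) (b u) t) d := by
  have key : ∀ r s : Fin 3, ∀ α β : Bool,
      (!elimFailBits r.val α β s.val) =
        (if (r.val + 3 - s.val) % 3 = 0 then β else if (r.val + 3 - s.val) % 3 = 1 then α else xor α β) := by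
    decide
  have heq : (fun u => winBit c (a u) (b u) t) = fun u =>
      (if (c % 3 + 3 - t % 3) % 3 = 0 then b u else if (c % 3 + 3 - t % 3) % 3 = 1 then a u
        else xor (a u) (b u)) := by
    funext u
    unfold winBit
    rw [elimFailBits_mod]
    exact key ⟨c % 3, Nat.mod_lt _ (by norm_num)⟩ ⟨t % 3, Nat.mod_lt _ (by norm_num)⟩ (a u) (b u)
  rw [heq]
  split_ifs
  · exact hb
  · exact ha
  · exact hasDeg_xor ha hb

/-- The three win bits of fixed stakes sum to zero. -/
theorem winBit_sum (c : ℕ) (α β : Bool) :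
    xor (winBit c α β 0) (xor (winBit c α β 1) (winBit c α β 2)) = false := by
  unfold winBit
  rw [elimFailBits_mod c α β 0, elimFailBits_mod c α β 1, elimFailBits_mod c α β 2]
  have key : ∀ r : Fin 3, ∀ α β : Bool,
      xor (!elimFailBits r.val α β (0 % 3)) (xor (!elimFailBits r.val α β (1 % 3))
        (!elimFailBits r.val α β (2 % 3))) = false := by decide
  exact key ⟨c % 3, Nat.mod_lt _ (by norm_num)⟩ α β

/-- Negation keeps the degree (`[¬f] = 1 + [f]`). -/
theorem hasDeg_not {k d : ℕ} {f : (Fin k → Bool) → Bool} (hf : HasDeg f d) :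
    HasDeg (fun u => !f u) d := by
  unfold HasDeg at *
  have heq : (fun x : Fin k → Bool => if (!f x) = true then (1 : ZMod 2) else 0) =
      1 + fun x => if f x = true then (1 : ZMod 2) else 0 := by
    funext x
    simp only [Pi.add_apply, Pi.one_apply]
    cases f x <;> decide
  rw [heq]
  exact Submodule.add_mem _ (one_mem_lowDeg₃ k d) hf

/-- The table depends on the weight only modulo `3`: at `u` the fail bit is the one at residue
`wt u % 3`. -/
private theorem elimFail_eq_residue (c : ℕ) (a b : (Fin L → Bool) → Bool) (u : Fin L → Bool) :
    elimFail c a b u =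
      (if wt u % 3 = 0 then elimFailBits c (a u) (b u) 0
        else if wt u % 3 = 1 then elimFailBits c (a u) (b u) 1 else elimFailBits c (a u) (b u) 2) := by
  unfold elimFail
  rw [elimFailBits_mod c (a u) (b u) (wt u), elimFailBits_mod c (a u) (b u) 0,
    elimFailBits_mod c (a u) (b u) 1, elimFailBits_mod c (a u) (b u) 2]
  have h3 : wt u % 3 = 0 ∨ wt u % 3 = 1 ∨ wt u % 3 = 2 := by omega
  rcases h3 with h | h | h <;> simp [h]

/-- **Win patterns of degree-`d` stakes lie in `C⁺` (Boolean form `InCPlus`), with even parity.** -/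
theorem inCPlus_win {d : ℕ} (c : ℕ) {a b : (Fin L → Bool) → Bool} (ha : HasDeg a d) (hb : HasDeg b d) :
    InCPlus d (fun u => !(elimFail c a b u)) := by
  refine ⟨fun u => winBit c (a u) (b u) 0, fun u => winBit c (a u) (b u) 1, fun u => winBit c (a u) (b u) 2,
    hasDeg_winBit c 0 ha hb, hasDeg_winBit c 1 ha hb, hasDeg_winBit c 2 ha hb,
    ⟨false, fun u => winBit_sum c (a u) (b u)⟩, fun u => ?_⟩
  show (!elimFail c a b u) = (if wt u % 3 = 0 then winBit c (a u) (b u) 0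
    else if wt u % 3 = 1 then winBit c (a u) (b u) 1 else winBit c (a u) (b u) 2)
  rw [elimFail_eq_residue]
  unfold winBit
  split_ifs <;> rfl

/-- **Fail patterns of degree-`d` stakes lie in `C⁺`, with odd parity.** -/
theorem inCPlus_fail {d : ℕ} (c : ℕ) {a b : (Fin L → Bool) → Bool} (ha : HasDeg a d) (hb : HasDeg b d) :
    InCPlus d (elimFail c a b) := by
  refine ⟨fun u => !winBit c (a u) (b u) 0, fun u => !winBit c (a u) (b u) 1,
    fun u => !winBit c (a u) (b u) 2, hasDeg_not (hasDeg_winBit c 0 ha hb),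
    hasDeg_not (hasDeg_winBit c 1 ha hb), hasDeg_not (hasDeg_winBit c 2 ha hb),
    ⟨true, fun u => ?_⟩, fun u => ?_⟩
  · show xor (!winBit c (a u) (b u) 0) (xor (!winBit c (a u) (b u) 1) (!winBit c (a u) (b u) 2)) = true
    have h := winBit_sum c (a u) (b u)
    revert h
    generalize winBit c (a u) (b u) 0 = x
    generalize winBit c (a u) (b u) 1 = y
    generalize winBit c (a u) (b u) 2 = z
    cases x <;> cases y <;> cases z <;> decide
  · show elimFail c a b u = (if wt u % 3 = 0 then !winBit c (a u) (b u) 0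
      else if wt u % 3 = 1 then !winBit c (a u) (b u) 1 else !winBit c (a u) (b u) 2)
    rw [elimFail_eq_residue]
    unfold winBit
    simp only [Bool.not_not]

/-- `Bool`-to-`𝔽₂` bookkeeping: the indicator of a piecewise function is the piecewise indicator. -/
private theorem indZ_piecewise (Q₀ Q₁ Q₂ : (Fin L → Bool) → Bool) (u : Fin L → Bool) :
    indZ (fun u => if wt u % 3 = 0 then Q₀ u else if wt u % 3 = 1 then Q₁ u else Q₂ u) u =
      pw (indZ Q₀) (indZ Q₁) (indZ Q₂) u := by
  simp only [indZ, pw]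
  split_ifs <;> rfl

/-- `Bool`-to-`𝔽₂` bookkeeping: XOR becomes addition of indicators. -/
private theorem indZ_xor3 (a b c e : Bool) (h : xor a (xor b c) = e) :
    (if a = true then (1 : ZMod 2) else 0) + (if b = true then 1 else 0) + (if c = true then 1 else 0) =
      (if e = true then 1 else 0) := by
  subst h
  cases a <;> cases b <;> cases c <;> decide

/-- **`InCPlus` functions lie in `C⁺`** (the `𝔽₂` model). -/
theorem indZ_mem_cplus_of_inCPlus {d : ℕ} {f : (Fin L → Bool) → Bool} (hf : InCPlus d f) :
    indZ f ∈ cplus L d := by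
  obtain ⟨Q₀, Q₁, Q₂, h₀, h₁, h₂, ⟨e, he⟩, hfeq⟩ := hf
  refine ⟨indZ Q₀, indZ Q₁, indZ Q₂, h₀, h₁, h₂, ⟨if e = true then 1 else 0, fun u => ?_⟩, ?_⟩
  · exact indZ_xor3 _ _ _ _ (he u)
  · funext u
    rw [← indZ_piecewise]
    unfold indZ
    rw [hfeq u]

/-- **Win patterns lie in `C`** (even parity). -/
theorem indZ_win_mem_code {d : ℕ} (c : ℕ) {a b : (Fin L → Bool) → Bool} (ha : HasDeg a d)
    (hb : HasDeg b d) : indZ (fun u => !(elimFail c a b u)) ∈ code L d := by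
  refine ⟨indZ fun u => winBit c (a u) (b u) 0, indZ fun u => winBit c (a u) (b u) 1,
    indZ fun u => winBit c (a u) (b u) 2, hasDeg_winBit c 0 ha hb, hasDeg_winBit c 1 ha hb,
    hasDeg_winBit c 2 ha hb, fun u => ?_, ?_⟩
  · have h := indZ_xor3 _ _ _ _ (winBit_sum c (a u) (b u))
    simpa [indZ] using h
  · funext u
    simp only [indZ, pw, winBit, elimFail_eq_residue c a b u]
    split_ifs <;> rfl

/-- **Fail patterns lie in the odd coset `𝟙 + C`.** -/
theorem indZ_fail_add_one_mem_code {d : ℕ} (c : ℕ) {a b : (Fin L → Bool) → Bool} (ha : HasDeg a d)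
    (hb : HasDeg b d) : indZ (elimFail c a b) + 1 ∈ code L d := by
  have heq : indZ (elimFail c a b) + 1 = indZ (fun u => !(elimFail c a b u)) := by
    funext u
    simp only [Pi.add_apply, Pi.one_apply, indZ]
    have key : ∀ x : Bool, (if x = true then (1 : ZMod 2) else 0) + 1 = (if (!x) = true then (1 : ZMod 2) else 0) := by
      decide
    exact key _
  rw [heq]
  exact indZ_win_mem_code c ha hb

end Summit.QuantumAdvantage.AdviceFreeQNC0
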